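import Summits.BirchSwinnertonDyer.BirchSwinnertonDyer.Theorems.ByReductionTypeAtTwoMultTowerSplitTowerAlgebra
import Literature.NumberTheory.GaloisRepresentations.FrobeniusQuotientHOne
import Literature.NumberTheory.EllipticCurves.SelmerCorankProofs
import Literature.NumberTheory.EllipticCurves.IwasawaSelmerControlLocalInputsProofs
import HarnessLib

/-!
# Route `ByReductionTypeAtTwo`, item `OrdKatoHalfAtTwo` (stmt-BirchSwinnertonDyer-19271), TOWER road, the
# GOOD-ORDINARY local constant at `v ∣ 2`: KERNEL BRICK G2 — the inflated cocycle of a coinvariant class on the local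
# layer group `H_n`, at ANY prime `p`

HONEST FRAMING (cell `bsd-2adic`, run/shared/lean/pub/bsd-2adic/, seat `bsd-2adic-tower-1` GEN 11, HUMAN RULINGS
D-0036 / D-0054 / D-0074): TOOL theorems only (no definition, no named fact, no `sorry`); closes nothing by itself;
nothing booked; BSD is not proved by any of this. Second brick of the KERNELISATION of the consumed projection
`#𝒦_{v,n}[2^∞][2] ≤ 4` of the PRINT binder `hS34 = Greenberg1999.lemma34_localTowerKerPrimary_cyclicExtension_rat`
(Greenberg, LNM 1716, §3 Lemma 3.4 / Prop. 2.5), scope memo HOME/tower/SCOPE-hS34-layer-kernel-at-2-GEN7.md §1 steps 2–3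
(«Kummer on `E₁`»). Setting: `p` any prime, `κ` the cyclotomic `ℤ_p`-extension of `ℚ`, `v ∋ p`, `K = ℚ_v`, `Γ = Gal(K̄/K)`,
`H_m = localSubgroup (κ.layerSubgroup m) K`, `H_∞ = localSubgroup κ.kerSubgroup K`, `E(K̄_v) = localPoints W K` for a
Weierstrass curve `W/ℚ`, `g ∈ H_n` a topological generator of `H_n` modulo `H_∞`.

* `exists_pow_inv_mul_mem_localSubgroup_layerSubgroup` — the cosets of `H_{n+R}` in `H_n` are `g^i H_{n+R}`, `i < p^R`
  (the `p`-general form of GEN 9's `MultTowerNS2.exists_pow_inv_mul_mem_localSubgroup_layerSubgroup`);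
* `exists_forall_mem_localSubgroup_layerSubgroup_smul_point_eq` — **finite level for points**: a point of `E(K̄_v)` fixed
  by `H_∞` is fixed by some `H_m` (coordinates + GEN 10's `MultTowerSP1.exists_forall_mem_localSubgroup_layerSubgroup_smul_eq`);
* `geomSum_nsmul`, `geomSum_smul_sub_eq`, `geomSum_mul_eq_nsmul_of_apply_eq` — bookkeeping for the geometric sums
  `S_i(x) = Σ_{j<i} g^j x` of the tree's `FrobeniusQuotientHOne` (`p S_i(x) = S_i(p x)`, `S_i(g y − y) = g^i y − y`,
  `S_{a k}(x) = k S_a(x)` when `g^a` fixes `S_a(x)`);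
* **`exists_contOneCocycles_inflate`** — for a `Γ`-stable subgroup `A₁ ≤ E(K̄_v)` whose `p`-torsion is fixed by `Γ`
  («`Ê[p] ⊂ Ê(𝔪_{ℚ_p})`», automatic at `p = 2`) and `x ∈ A₁`, `y` fixed by `H_∞` with `p x = g y − y` (a `p`-TORSION
  COINVARIANT CLASS `[x]` of `A₁^{H_∞}/(g − 1)`), there is a continuous `1`-cocycle `c` of `H_n` with values in `A₁`,
  vanishing on `H_∞`, with `c(g) = x` and `p c(σ) = σ y − y` for all `σ ∈ H_n`: the cocycle `σ = g^i h ↦ S_i(x)` of the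
  finite cyclic level `H_n/H_{n+R}` (the norm `S_{p^R}(x)` vanishes one level above the level fixing `x, y`, because
  `p S_{p^{R−1}}(x) = g^{p^{R−1}} y − y = 0` puts `S_{p^{R−1}}(x)` in the `Γ`-fixed `A₁[p]`).
  Part 2 (`…GoodOrdTowerCoinvKummer.lean`) turns `c − ∂ỹ` (`p ỹ = y`) into a `Γ`-fixed-`A₁[p]`-valued character of `H_n` and
  counts: `#(A₁^{H_∞}/(g−1))[p] · #(A₁^{H_n}/p) ≤ #Hom_cont(H_n, A₁[p])`.

References: R. Greenberg, LNM 1716 (1999), §3 Lemma 3.1 (p. 86: `H¹(Γ_n, B) = B/(γ − 1)B`), Lemma 3.4 (p. 89); J.-P. Serre,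
*Local Fields*, XIII §1 Prop. 1; L. Washington, *Introduction to Cyclotomic Fields*, §13.1; scope memo §1.
-/

set_option autoImplicit false
-- the Theorems namespace of this sub repeats the summit name by design (D-0017 nested layout: Summit.<S>.<Sub>)
set_option linter.dupNamespace false

noncomputable section

open scoped Classical

universe u

namespace Summit.BirchSwinnertonDyer.BirchSwinnertonDyer.Theorems.GoodOrdTower

open NumberField IsDedekindDomain Field PadicInt Literature.NumberTheory.EllipticCurves
  Literature.NumberTheory.GaloisRepresentations WeierstrassCurve

variable {p : ℕ} [Fact p.Prime] {κ : ZpExtension ℚ p}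

/-! ### Cosets of `H_{n+R}` in `H_n` -/

/-- **The cosets of `H_{n+R}` in `H_n` are `g^i H_{n+R}`, `i < p^R`**: for `g` with `κ(res g) = p^n u` (`u` a unit) and
`h ∈ H_n` there is `i < p^R` with `(g^i)⁻¹ h ∈ H_{n+R}` (`κ(res h) = p^n c`, `i ≡ c u⁻¹ (mod p^R)`). The `p`-general form of
`MultTowerNS2.exists_pow_inv_mul_mem_localSubgroup_layerSubgroup`. [cite: Washington1997, §13.1] -/
theorem exists_pow_inv_mul_mem_localSubgroup_layerSubgroup (v : HeightOneSpectrum (𝓞 ℚ)) (n R : ℕ)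
    {g : absoluteGaloisGroup (v.adicCompletion ℚ)} {u : ℤ_[p]ˣ}
    (hu : ((κ (resGal (K := ℚ) (v.adicCompletion ℚ) g)).toAdd : ℤ_[p]) = (p : ℤ_[p]) ^ n * (u : ℤ_[p]))
    {h : absoluteGaloisGroup (v.adicCompletion ℚ)} (hh : h ∈ localSubgroup (κ.layerSubgroup n) (v.adicCompletion ℚ)) :
    ∃ i : ℕ, i < p ^ R ∧ (g ^ i)⁻¹ * h ∈ localSubgroup (κ.layerSubgroup (n + R)) (v.adicCompletion ℚ) := by
  rw [mem_localSubgroup_iff, ZpExtension.mem_layerSubgroup] at hh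
  obtain ⟨c, hc⟩ := hh
  set i : ℕ := (toZModPow R (c * ((u⁻¹ : ℤ_[p]ˣ) : ℤ_[p]))).val with hi
  refine ⟨i, ZMod.val_lt _, ?_⟩
  rw [mem_localSubgroup_iff, ZpExtension.mem_layerSubgroup]
  simp only [map_mul, map_inv, map_pow, toAdd_mul, toAdd_inv, toAdd_pow, hu]
  have hc' : ((κ (resGal (K := ℚ) (v.adicCompletion ℚ) h)).toAdd : ℤ_[p]) = (p : ℤ_[p]) ^ n * c := by exact_mod_cast hc
  rw [hc']
  -- `c u⁻¹ - i ∈ p^R ℤ_p`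
  have hker : c * ((u⁻¹ : ℤ_[p]ˣ) : ℤ_[p]) - (i : ℤ_[p]) ∈ RingHom.ker (toZModPow (p := p) R) := by
    rw [RingHom.mem_ker, map_sub, map_natCast, hi, ZMod.natCast_zmod_val, sub_self]
  rw [ker_toZModPow, Ideal.mem_span_singleton] at hker
  obtain ⟨d, hd⟩ := hker
  refine ⟨(u : ℤ_[p]) * d, ?_⟩
  have hud : c - (i : ℤ_[p]) * (u : ℤ_[p]) = (u : ℤ_[p]) * ((p : ℤ_[p]) ^ R * d) := by
    have h1 : (u : ℤ_[p]) * (c * ((u⁻¹ : ℤ_[p]ˣ) : ℤ_[p]) - (i : ℤ_[p])) = c - (i : ℤ_[p]) * (u : ℤ_[p]) := by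
      rw [mul_sub, ← mul_assoc, mul_comm (u : ℤ_[p]) c, mul_assoc, Units.mul_inv, mul_one, mul_comm]
    rw [← h1, hd]
  rw [nsmul_eq_mul]
  linear_combination (p : ℤ_[p]) ^ n * hud

/-! ### Finite level for points -/

/-- Two affine points with equal coordinates are equal (the nonsingularity proofs are irrelevant). [folklore] -/
private theorem point_some_eq_some {F : Type u} [Field F] {V : WeierstrassCurve F} {x x' y y' : F}
    (hx : x = x') (hy : y = y') {h : V.toAffine.Nonsingular x y} {h' : V.toAffine.Nonsingular x' y'} :
    Affine.Point.some x y h = Affine.Point.some x' y' h' := by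
  subst hx; subst hy; rfl

/-- **Finite level for points**: a point of `E(K̄_v)` fixed by every element of `H_∞` is fixed by every element of some
`H_m` (apply the field-element statement `MultTowerSP1.exists_forall_mem_localSubgroup_layerSubgroup_smul_eq` to the two
coordinates and take the larger level). [cite: NeukirchANT1999, Ch. IV §1] -/
theorem exists_forall_mem_localSubgroup_layerSubgroup_smul_point_eq (v : HeightOneSpectrum (𝓞 ℚ))
    (W : WeierstrassCurve ℚ) (P : localPoints W (v.adicCompletion ℚ))
    (hP : ∀ h ∈ localSubgroup κ.kerSubgroup (v.adicCompletion ℚ), h • P = P) :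
    ∃ m : ℕ, ∀ h ∈ localSubgroup (κ.layerSubgroup m) (v.adicCompletion ℚ), h • P = P := by
  change (W.baseChange (AlgebraicClosure (v.adicCompletion ℚ))).toAffine.Point at P
  rcases P with _ | ⟨x, y, hxy⟩
  · exact ⟨0, fun h _ ↦ smul_zero h⟩
  · -- `h • (x, y) = (h x, h y)`
    have hsm : ∀ h : absoluteGaloisGroup (v.adicCompletion ℚ), ∃ h₂,
        h • (show localPoints W (v.adicCompletion ℚ) from Affine.Point.some x y hxy) =
          Affine.Point.some (h • x) (h • y) h₂ := fun h ↦
      ⟨_, by rw [localPoints.smul_def, Affine.Point.map_some]; rfl⟩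
    -- the coordinates are fixed by `H_∞`
    have hcoord : ∀ h ∈ localSubgroup κ.kerSubgroup (v.adicCompletion ℚ), h • x = x ∧ h • y = y := by
      intro h hh
      obtain ⟨h₂, e⟩ := hsm h
      have e' := hP h hh
      rw [e] at e'
      injection e' with ex ey
      exact ⟨ex, ey⟩
    obtain ⟨m₁, hm₁⟩ := MultTowerSP1.exists_forall_mem_localSubgroup_layerSubgroup_smul_eq (κ := κ) v x
      fun h hh ↦ (hcoord h hh).1
    obtain ⟨m₂, hm₂⟩ := MultTowerSP1.exists_forall_mem_localSubgroup_layerSubgroup_smul_eq (κ := κ) v y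
      fun h hh ↦ (hcoord h hh).2
    refine ⟨max m₁ m₂, fun h hh ↦ ?_⟩
    have h₁ : h • x = x :=
      hm₁ h (MultTowerSP1.localSubgroup_layerSubgroup_antitone κ (v.adicCompletion ℚ) (le_max_left m₁ m₂) hh)
    have h₂ : h • y = y :=
      hm₂ h (MultTowerSP1.localSubgroup_layerSubgroup_antitone κ (v.adicCompletion ℚ) (le_max_right m₁ m₂) hh)
    obtain ⟨h₃, e⟩ := hsm h
    rw [e]
    exact point_some_eq_some h₁ h₂

/-! ### Geometric sums in a discrete module -/

section GeomSum

variable {G : Type u} [Group G] {X : TopRep.{u} ℤ G} (F : G)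

/-- `S_i(n • b) = n • S_i(b)`. [folklore] -/
theorem geomSum_nsmul (b₀ : X) (n i : ℕ) : geomSum F (n • b₀) i = n • geomSum F b₀ i := by
  simp only [geomSum, map_nsmul, Finset.smul_sum]

/-- Telescoping: `S_i(F y − y) = F^i y − y`. [folklore] -/
theorem geomSum_smul_sub_eq (y : X) (i : ℕ) : geomSum F (X.ρ F y - y) i = X.ρ (F ^ i) y - y := by
  induction i with
  | zero => rw [geomSum_zero, pow_zero, map_one]; exact (sub_self _).symm
  | succ i ih =>
    rw [geomSum_succ, ih, map_sub, ← mul_apply_eq_comp, ← map_mul, ← pow_succ]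
    abel

/-- `S_{a k}(b) = k • S_a(b)` as soon as `F^a` fixes `S_a(b)` (the tree's `geomSum_mul_eq_smul` asks `F^a` to act
trivially on the whole module). [folklore] -/
theorem geomSum_mul_eq_nsmul_of_apply_eq (b₀ : X) {a : ℕ} (ha : X.ρ (F ^ a) (geomSum F b₀ a) = geomSum F b₀ a)
    (k : ℕ) : geomSum F b₀ (a * k) = k • geomSum F b₀ a := by
  have hak : ∀ k : ℕ, X.ρ (F ^ (a * k)) (geomSum F b₀ a) = geomSum F b₀ a := fun k ↦ by
    induction k with
    | zero => rw [mul_zero, pow_zero, map_one]; rfl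
    | succ k ih => rw [Nat.mul_succ, pow_add, map_mul, mul_apply_eq_comp, ha, ih]
  induction k with
  | zero => rw [mul_zero, geomSum_zero, zero_smul]
  | succ k ih => rw [Nat.mul_succ, geomSum_add, ih, hak, succ_nsmul]

end GeomSum

/-! ### The inflated cocycle of a `p`-torsion coinvariant class -/

/-- **The inflated cocycle of a `p`-torsion coinvariant class.** Let `A₁ ≤ E(K̄_v)` be a `Γ`-stable subgroup whose
`p`-torsion elements are fixed by `Γ`, `g ∈ H_n` a topological generator of `H_n` modulo `H_∞` (the binder shape of BRICK
11 `MultTowerNS2.finite_torsionBy_localTowerKerPrimary_and_card_le`), and `x ∈ A₁`, `y ∈ E(K̄_v)` fixed by `H_∞` with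
`p x = g y − y`.
Then there is a continuous `1`-cocycle `c` of `H_n` with values in `E(K̄_v)` such that `c` vanishes on `H_∞`, `c(g) = x`,
`c(σ) ∈ A₁` and `p c(σ) = σ y − y` for every `σ ∈ H_n`. Construction: `x, y` are fixed by some `H_{n+R₀}` (finite level);
with `R = R₀ + 1` the geometric sums `S_i(x) = Σ_{j<i} g^j x` satisfy `S_{p^R}(x) = p S_{p^{R₀}}(x) = 0` (as
`p S_{p^{R₀}}(x) = S_{p^{R₀}}(g y − y) = g^{p^{R₀}} y − y = 0`, so `S_{p^{R₀}}(x) ∈ A₁[p]` is fixed by `g^{p^{R₀}}`), hence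
`σ = g^i h ↦ S_i(x)` (`h ∈ H_{n+R}`) is a well-defined cocycle of the cyclic group `H_n/H_{n+R} = ⟨ḡ⟩` of order `p^R`,
inflated to `H_n` (the tree's `geomSum`/`idxQ` of `FrobeniusQuotientHOne` / `CyclicQuotientTwoCocycle`).
[cite: GreenbergLNM1716, §3 Lemma 3.1 (p. 86)] [cite: SerreLocalFields1979, XIII §1 Prop. 1] -/
theorem exists_contOneCocycles_inflate (hκ : κ.IsCyclotomic) (v : HeightOneSpectrum (𝓞 ℚ))
    (hv : ((p : ℕ) : 𝓞 ℚ) ∈ v.asIdeal) (W : WeierstrassCurve ℚ) (n : ℕ)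
    {g : absoluteGaloisGroup (v.adicCompletion ℚ)}
    (hg : g ∈ localSubgroup (κ.layerSubgroup n) (v.adicCompletion ℚ))
    (hgen : ∀ U : Subgroup (absoluteGaloisGroup (v.adicCompletion ℚ)),
      IsOpen (U : Set (absoluteGaloisGroup (v.adicCompletion ℚ))) →
        localSubgroup κ.kerSubgroup (v.adicCompletion ℚ) ≤ U → g ∈ U →
          localSubgroup (κ.layerSubgroup n) (v.adicCompletion ℚ) ≤ U)
    (A₁ : AddSubgroup (localPoints W (v.adicCompletion ℚ)))
    (hstab : ∀ (σ : absoluteGaloisGroup (v.adicCompletion ℚ)) (a : localPoints W (v.adicCompletion ℚ)),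
      a ∈ A₁ → σ • a ∈ A₁)
    (hZ : ∀ a ∈ A₁, p • a = 0 → ∀ σ : absoluteGaloisGroup (v.adicCompletion ℚ), σ • a = a)
    {x y : localPoints W (v.adicCompletion ℚ)} (hx : x ∈ A₁)
    (hxi : ∀ h ∈ localSubgroup κ.kerSubgroup (v.adicCompletion ℚ), h • x = x)
    (hyi : ∀ h ∈ localSubgroup κ.kerSubgroup (v.adicCompletion ℚ), h • y = y)
    (hrel : p • x = g • y - y) :
    ∃ c : contOneCocycles (discreteTopRep (localSubgroup (κ.layerSubgroup n) (v.adicCompletion ℚ))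
      (localPoints W (v.adicCompletion ℚ))),
      (∀ σ : localSubgroup (κ.layerSubgroup n) (v.adicCompletion ℚ),
        (σ : absoluteGaloisGroup (v.adicCompletion ℚ)) ∈ localSubgroup κ.kerSubgroup (v.adicCompletion ℚ) →
          c.1 σ = 0) ∧
      c.1 ⟨g, hg⟩ = x ∧
      (∀ σ : localSubgroup (κ.layerSubgroup n) (v.adicCompletion ℚ), c.1 σ ∈ A₁) ∧
      (∀ σ : localSubgroup (κ.layerSubgroup n) (v.adicCompletion ℚ),
        p • c.1 σ = (σ : absoluteGaloisGroup (v.adicCompletion ℚ)) • y - y) := by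
  -- notation (`let`, not `set`: no context rewriting)
  let K := v.adicCompletion ℚ
  let P : Type := localPoints W K
  let Hn : Subgroup (absoluteGaloisGroup K) := localSubgroup (κ.layerSubgroup n) K
  let X : TopRep ℤ Hn := discreteTopRep Hn P
  let γ : Hn := ⟨g, hg⟩
  have hXρ : ∀ (σ : Hn) (m : P), X.ρ σ m = (σ : absoluteGaloisGroup K) • m := fun _ _ ↦ rfl
  have hXρpow : ∀ (j : ℕ) (m : P), X.ρ (γ ^ j) m = (g ^ j) • m := fun j m ↦ by
    rw [hXρ, SubgroupClass.coe_pow]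
  -- `κ(res g) = p^n u`
  obtain ⟨u, hu⟩ := MultTowerSP1.exists_units_kappa_resGal_eq_of_generate hκ v hv n hg hgen
  have hgi : ∀ (R i : ℕ), g ^ i ∈ localSubgroup (κ.layerSubgroup (n + R)) K ↔ p ^ R ∣ i := fun R i ↦
    MultTowerSP1.pow_mem_localSubgroup_layerSubgroup_iff (κ := κ) v n R hu i
  -- a common finite level `n + R₀` for `x` and `y`
  obtain ⟨m₁, hm₁⟩ := exists_forall_mem_localSubgroup_layerSubgroup_smul_point_eq (κ := κ) v W x hxi
  obtain ⟨m₂, hm₂⟩ := exists_forall_mem_localSubgroup_layerSubgroup_smul_point_eq (κ := κ) v W y hyi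
  obtain ⟨R₀, hxR₀, hyR₀⟩ : ∃ R₀ : ℕ, (∀ h ∈ localSubgroup (κ.layerSubgroup (n + R₀)) K, h • x = x) ∧
      ∀ h ∈ localSubgroup (κ.layerSubgroup (n + R₀)) K, h • y = y :=
    ⟨max m₁ m₂,
      fun h hh ↦ hm₁ h (MultTowerSP1.localSubgroup_layerSubgroup_antitone κ K
        ((le_max_left m₁ m₂).trans (Nat.le_add_left _ n)) hh),
      fun h hh ↦ hm₂ h (MultTowerSP1.localSubgroup_layerSubgroup_antitone κ K
        ((le_max_right m₁ m₂).trans (Nat.le_add_left _ n)) hh)⟩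
  have hleR : localSubgroup (κ.layerSubgroup (n + (R₀ + 1))) K ≤ localSubgroup (κ.layerSubgroup (n + R₀)) K :=
    MultTowerSP1.localSubgroup_layerSubgroup_antitone κ K (by omega)
  have hxR : ∀ h ∈ localSubgroup (κ.layerSubgroup (n + (R₀ + 1))) K, h • x = x := fun h hh ↦ hxR₀ h (hleR hh)
  have hyR : ∀ h ∈ localSubgroup (κ.layerSubgroup (n + (R₀ + 1))) K, h • y = y := fun h hh ↦ hyR₀ h (hleR hh)
  -- the open normal subgroup `H = H_{n+R₀+1} ∩ H_n` of `H_n` and the cyclic quotient `H_n / H = ⟨ḡ⟩`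
  have hnormal : (localSubgroup (κ.layerSubgroup (n + (R₀ + 1))) K).Normal := by
    rw [localSubgroup_eq_comap]; exact Subgroup.Normal.comap inferInstance _
  let H : Subgroup Hn := (localSubgroup (κ.layerSubgroup (n + (R₀ + 1))) K).subgroupOf Hn
  haveI hHnormal : H.Normal := Subgroup.normal_subgroupOf
  have hmemH : ∀ σ : Hn, σ ∈ H ↔
      (σ : absoluteGaloisGroup K) ∈ localSubgroup (κ.layerSubgroup (n + (R₀ + 1))) K :=
    fun σ ↦ Subgroup.mem_subgroupOf
  have hHopen : IsOpen (H : Set Hn) :=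
    (MultTowerNS2.isOpen_localSubgroup _ (κ.isOpen_layerSubgroup (n + (R₀ + 1))) K).preimage
      continuous_subtype_val
  have hgenQ : ∀ q : Hn ⧸ H, ∃ i : ℕ, q = (QuotientGroup.mk γ : Hn ⧸ H) ^ i := by
    intro q
    obtain ⟨σ, rfl⟩ := QuotientGroup.mk_surjective q
    obtain ⟨i, -, hi⟩ := exists_pow_inv_mul_mem_localSubgroup_layerSubgroup (κ := κ) v n (R₀ + 1) hu σ.2
    refine ⟨i, ?_⟩
    rw [← QuotientGroup.mk_pow, eq_comm, QuotientGroup.eq, hmemH]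
    simpa only [Subgroup.coe_mul, Subgroup.coe_inv, SubgroupClass.coe_pow] using hi
  -- the order of `ḡ` is `p^(R₀+1)`
  have hord : orderOf (QuotientGroup.mk γ : Hn ⧸ H) = p ^ (R₀ + 1) := by
    have key : ∀ i : ℕ, (QuotientGroup.mk γ : Hn ⧸ H) ^ i = 1 ↔ p ^ (R₀ + 1) ∣ i := fun i ↦ by
      rw [← QuotientGroup.mk_pow, QuotientGroup.eq_one_iff, hmemH, SubgroupClass.coe_pow]
      exact hgi (R₀ + 1) i
    exact Nat.dvd_antisymm (orderOf_dvd_of_pow_eq_one ((key _).mpr dvd_rfl)) ((key _).mp (pow_orderOf_eq_one _))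
  -- every `S_i(x)` lies in `A₁`
  have hSA : ∀ i : ℕ, geomSum (X := X) γ x i ∈ A₁ := fun i ↦ by
    induction i with
    | zero => rw [geomSum_zero]; exact A₁.zero_mem
    | succ i ih => rw [geomSum_succ, hXρpow]; exact A₁.add_mem ih (hstab _ _ hx)
  -- the norm vanishes: `S_{p^(R₀+1)}(x) = 0`
  have hN : geomSum (X := X) γ x (orderOf (QuotientGroup.mk γ : Hn ⧸ H)) = 0 := by
    rw [hord]
    -- `p • S_{p^{R₀}}(x) = g^{p^{R₀}} y - y = 0`
    have hgR₀ : g ^ p ^ R₀ ∈ localSubgroup (κ.layerSubgroup (n + R₀)) K := (hgi R₀ _).mpr dvd_rfl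
    have hpS : p • geomSum (X := X) γ x (p ^ R₀) = 0 := by
      rw [← geomSum_nsmul (X := X), hrel, ← hXρ γ y, geomSum_smul_sub_eq (X := X), hXρpow, hyR₀ _ hgR₀,
        sub_self]
    -- hence `S_{p^{R₀}}(x) ∈ A₁[p]` is fixed by `g^{p^{R₀}}`, and `S_{p^{R₀+1}}(x) = p • S_{p^{R₀}}(x)`
    have hfix : X.ρ (γ ^ p ^ R₀) (geomSum (X := X) γ x (p ^ R₀)) = geomSum (X := X) γ x (p ^ R₀) := by
      rw [hXρpow]; exact hZ _ (hSA _) hpS _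
    rw [pow_succ, geomSum_mul_eq_nsmul_of_apply_eq (X := X) γ x hfix p, hpS]
  -- translates of `x` are fixed by `H_{n+R₀+1}` (normality), hence so are the sums `S_i(x)`
  have hfixS : ∀ h ∈ localSubgroup (κ.layerSubgroup (n + (R₀ + 1))) K,
      ∀ i : ℕ, h • geomSum (X := X) γ x i = geomSum (X := X) γ x i := by
    intro h hh i
    induction i with
    | zero => rw [geomSum_zero, smul_zero]
    | succ i ih =>
      rw [geomSum_succ, smul_add, ih, hXρpow]
      congr 1
      have hconj : (g ^ i)⁻¹ * h * (g ^ i) ∈ localSubgroup (κ.layerSubgroup (n + (R₀ + 1))) K := by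
        have := hnormal.conj_mem h hh (g ^ i)⁻¹
        rwa [inv_inv] at this
      calc h • (g ^ i) • x = (g ^ i) • (((g ^ i)⁻¹ * h * g ^ i) • x) := by
            rw [← mul_smul, ← mul_smul]; congr 1; group
        _ = (g ^ i) • x := by rw [hxR _ hconj]
  -- the cocycle `σ = g^i h ↦ S_i(x)`
  let f : Hn → P := fun σ ↦ geomSum (X := X) γ x (idxQ H γ hgenQ (σ : Hn ⧸ H))
  have hf_cont : Continuous f := by
    haveI : DiscreteTopology (Hn ⧸ H) := QuotientGroup.discreteTopology hHopen
    have hc : Continuous (fun q : Hn ⧸ H ↦ geomSum (X := X) γ x (idxQ H γ hgenQ q)) :=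
      continuous_of_discreteTopology
    exact hc.comp QuotientGroup.continuous_mk
  -- `σ = g^{idx σ} · h` with `h ∈ H_{n+R₀+1}`
  have hdec : ∀ σ : Hn, ((g ^ idxQ H γ hgenQ (σ : Hn ⧸ H))⁻¹ * (σ : absoluteGaloisGroup K)) ∈
      localSubgroup (κ.layerSubgroup (n + (R₀ + 1))) K := fun σ ↦ by
    have hh := pow_idxQ_inv_mul_mem H γ hgenQ σ
    rw [hmemH] at hh
    simpa only [Subgroup.coe_mul, Subgroup.coe_inv, SubgroupClass.coe_pow] using hh
  have hsplit : ∀ (σ : Hn) (m : P), (σ : absoluteGaloisGroup K) • m =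
      (g ^ idxQ H γ hgenQ (σ : Hn ⧸ H)) • ((g ^ idxQ H γ hgenQ (σ : Hn ⧸ H))⁻¹ * (σ : absoluteGaloisGroup K)) • m :=
    fun σ m ↦ by rw [← mul_smul, mul_inv_cancel_left]
  let c : contOneCocycles X := ⟨⟨f, hf_cont⟩, fun σ τ ↦ by
    change geomSum (X := X) γ x (idxQ H γ hgenQ ((σ * τ : Hn) : Hn ⧸ H)) =
      geomSum (X := X) γ x (idxQ H γ hgenQ (σ : Hn ⧸ H)) +
        X.ρ σ (geomSum (X := X) γ x (idxQ H γ hgenQ (τ : Hn ⧸ H)))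
    rw [geomSum_eq_of_modEq (X := X) γ x hN (idxQ_mul_modEq H γ hgenQ σ τ), geomSum_add, hXρ σ, hsplit σ,
      hfixS _ (hdec σ), hXρpow]⟩
  have hc_apply : ∀ σ : Hn, c.1 σ = geomSum (X := X) γ x (idxQ H γ hgenQ (σ : Hn ⧸ H)) := fun _ ↦ rfl
  refine ⟨c, fun σ hσ ↦ ?_, ?_, fun σ ↦ by rw [hc_apply]; exact hSA _, fun σ ↦ ?_⟩
  · -- vanishing on `H_∞ ⊆ H_{n+R₀+1}`: `idx σ ≡ 0`
    rw [hc_apply]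
    have hσH : σ ∈ H := by
      rw [hmemH, mem_localSubgroup_iff]
      exact κ.kerSubgroup_le_layerSubgroup (n + (R₀ + 1)) ((mem_localSubgroup_iff _ _ _).mp hσ)
    have h1 : (σ : Hn ⧸ H) = 1 := (QuotientGroup.eq_one_iff σ).mpr hσH
    have h0 : idxQ H γ hgenQ (σ : Hn ⧸ H) ≡ 0 [MOD orderOf (QuotientGroup.mk γ : Hn ⧸ H)] := by
      rw [← pow_eq_pow_iff_modEq, pow_zero, ← idxQ_spec H γ hgenQ (σ : Hn ⧸ H), h1]
    rw [geomSum_eq_of_modEq (X := X) γ x hN h0, geomSum_zero]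
  · -- `c(g) = S_1(x) = x`
    rw [hc_apply]
    have h1 : idxQ H γ hgenQ (γ : Hn ⧸ H) ≡ 1 [MOD orderOf (QuotientGroup.mk γ : Hn ⧸ H)] := by
      rw [← pow_eq_pow_iff_modEq, pow_one]
      exact (idxQ_spec H γ hgenQ (γ : Hn ⧸ H)).symm
    rw [geomSum_eq_of_modEq (X := X) γ x hN h1, geomSum_one]
  · -- `p • S_i(x) = S_i(g y - y) = g^i y - y = σ y - y`
    rw [hc_apply, ← geomSum_nsmul (X := X), hrel, ← hXρ γ y, geomSum_smul_sub_eq (X := X), hXρpow,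
      hsplit σ y, hyR _ (hdec σ)]

end Summit.BirchSwinnertonDyer.BirchSwinnertonDyer.Theorems.GoodOrdTower

end
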